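import Summits.CriticalPhenomena.PercolationContinuityZ3.Theorems.PercNearOneGluingNoHeavyLowerTailTwoCopyRelabel
import Summits.CriticalPhenomena.PercolationContinuityZ3.Theorems.PercNearOneGluingNoHeavyLowerTailLonelyRelay

/-!
# Crux `NoHeavyLowerTail` (stmt-CriticalPhenomena-4575), certificate programme for the `|A| = 5` one-cut rung:
# assembly on six vertices from the two canonical positions

On `Fin 6` with `|A| = 5` there is exactly one vertex `f ∉ A`; either the observer is `f` (observer not a
relay) or the observer is a relay.  By the relabelling invariance `oneCut_of_relabel`, the one-cut bound
for ALL `(w, A, o)` follows from the two CANONICAL positions: observer `0` with relays `{0,1,2,3,4}`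
(free vertex `5`) and observer `0` with relays `{1,2,3,4,5}`, each in the lower-tail form
`P(1 ≤ N ≤ 2) ≤ t` under `Σ_a P(o ↔ a) > 4` (the case `Σ ≤ 4` is `Theorems.oneCut_of_sum_le_four`).
`oneCut_five_fin6_of` performs this reduction; the two canonical statements are its hypotheses, to be
discharged by certificate files.  Nothing here asserts anything about the crux.
-/

namespace Summit.CriticalPhenomena.PercolationContinuityZ3.Theorems.TwoCopy

open Finset MeasureTheory
open Literature.Probability.Percolation Literature.Probability.LatticeModels
open scoped Classical

/-- Canonical relay list, observer a relay: `{0,1,2,3,4}` (free vertex `5`). [this work] -/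
def As6A : List (Fin 6) := [0, 1, 2, 3, 4]

/-- Canonical relay list, observer not a relay: `{1,2,3,4,5}` (observer `0`). [this work] -/
def As6B : List (Fin 6) := [1, 2, 3, 4, 5]

/-- `As6A` enumerates `univ ∖ {5}`. [this work] -/
theorem toFinset_As6A : As6A.toFinset = (Finset.univ : Finset (Fin 6)).erase 5 := by decide

/-- `As6B` enumerates `univ ∖ {0}`. [this work] -/
theorem toFinset_As6B : As6B.toFinset = (Finset.univ : Finset (Fin 6)).erase 0 := by decide

/-- A permutation of `Fin 6` sending `o ↦ 0` and `f ↦ 5` (`o ≠ f`). [this work] -/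
theorem exists_perm_zero_five (o f : Fin 6) (hof : o ≠ f) : ∃ σ : Equiv.Perm (Fin 6), σ o = 0 ∧ σ f = 5 := by
  refine ⟨(Equiv.swap o 0).trans (Equiv.swap (Equiv.swap o 0 f) 5), ?_, ?_⟩
  · rw [Equiv.trans_apply, Equiv.swap_apply_left]
    apply Equiv.swap_apply_of_ne_of_ne
    · intro h
      apply hof
      have h1 : Equiv.swap o 0 o = Equiv.swap o 0 f := by rw [Equiv.swap_apply_left]; exact h
      exact (Equiv.swap o 0).injective h1
    · decide
  · rw [Equiv.trans_apply, Equiv.swap_apply_left]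

/-- The lower-tail event at `|A| = 5`, `Σ_a P(o ↔ a) > 4` contains the one-cut event. [this work] -/
theorem oneCut_event_subset {n : ℕ} (w : Sym2 (Fin n) → unitInterval) (A : Finset (Fin n)) (o : Fin n)
    (hA : A.card = 5) :
    {ω : BondConfig (Fin n) | 1 ≤ (A.filter fun a => ω ∈ openConn o a).card ∧
        ((A.filter fun a => ω ∈ openConn o a).card : ℝ) < (∑ a ∈ A, (prodBernoulli w).real (openConn o a)) / 2} ⊆
      {ω : Set (Sym2 (Fin n)) | 1 ≤ (A.filter fun x => ω ∈ openConn o x).card ∧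
        (A.filter fun x => ω ∈ openConn o x).card ≤ 2} := by
  have hEN5 : (∑ a ∈ A, (prodBernoulli w).real (openConn o a)) ≤ 5 := by
    calc (∑ a ∈ A, (prodBernoulli w).real (openConn o a)) ≤ ∑ _a ∈ A, (1 : ℝ) :=
        Finset.sum_le_sum fun a _ => measureReal_le_one
      _ = 5 := by simp [hA]
  intro ω hω
  simp only [Set.mem_setOf_eq] at hω ⊢
  refine ⟨hω.1, ?_⟩
  have h2 : ((A.filter fun a => ω ∈ openConn o a).card : ℝ) < 3 := by linarith [hω.2]
  have : (A.filter fun a => ω ∈ openConn o a).card < 3 := by exact_mod_cast h2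
  omega

/-- **Assembly on six vertices.**  The one-cut bound (`stub_oneCut` shape, constant `1`) for every weighted
graph on `Fin 6` with `|A| = 5`, from the two canonical lower-tail statements. [this work] -/
theorem oneCut_five_fin6_of
    (hIn : ∀ (w : Sym2 (Fin 6) → unitInterval),
      4 < (∑ x ∈ As6A.toFinset, (prodBernoulli w).real (openConn (0 : Fin 6) x)) → ∀ t : ℝ, 0 ≤ t →
      (∀ x ∈ As6A.toFinset, ∀ x' ∈ As6A.toFinset, x ≠ x' → (prodBernoulli w).real (openConn x x')ᶜ ≤ t) →
      (prodBernoulli w).real {ω : Set (Sym2 (Fin 6)) | 1 ≤ (As6A.toFinset.filter fun x => ω ∈ openConn (0 : Fin 6) x).card ∧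
        (As6A.toFinset.filter fun x => ω ∈ openConn (0 : Fin 6) x).card ≤ 2} ≤ t)
    (hOut : ∀ (w : Sym2 (Fin 6) → unitInterval),
      4 < (∑ x ∈ As6B.toFinset, (prodBernoulli w).real (openConn (0 : Fin 6) x)) → ∀ t : ℝ, 0 ≤ t →
      (∀ x ∈ As6B.toFinset, ∀ x' ∈ As6B.toFinset, x ≠ x' → (prodBernoulli w).real (openConn x x')ᶜ ≤ t) →
      (prodBernoulli w).real {ω : Set (Sym2 (Fin 6)) | 1 ≤ (As6B.toFinset.filter fun x => ω ∈ openConn (0 : Fin 6) x).card ∧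
        (As6B.toFinset.filter fun x => ω ∈ openConn (0 : Fin 6) x).card ≤ 2} ≤ t) :
    ∀ (w : Sym2 (Fin 6) → unitInterval) (A : Finset (Fin 6)) (o : Fin 6) (t : ℝ), A.card = 5 → 0 ≤ t →
      (∀ a ∈ A, ∀ a' ∈ A, a ≠ a' → (prodBernoulli w).real (openConn a a')ᶜ ≤ t) →
      (prodBernoulli w).real {ω : BondConfig (Fin 6) |
          1 ≤ (A.filter fun a => ω ∈ openConn o a).card ∧
          ((A.filter fun a => ω ∈ openConn o a).card : ℝ) <
            (∑ a ∈ A, (prodBernoulli w).real (openConn o a)) / 2} ≤ t := by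
  intro w A o t hA ht hcut
  by_cases hEN : (∑ a ∈ A, (prodBernoulli w).real (openConn o a)) ≤ 4
  · exact oneCut_of_sum_le_four 6 w A o t hEN ht hcut
  rw [not_le] at hEN
  -- the vertex outside `A`
  have hAc : Aᶜ.card = 1 := by rw [Finset.card_compl, hA]; simp
  obtain ⟨f, hf⟩ := Finset.card_eq_one.1 hAc
  have hmem : ∀ x, x ∈ A ↔ x ≠ f := by
    intro x
    have h1 := Finset.mem_compl (s := A) (a := x)
    rw [hf, Finset.mem_singleton] at h1
    tauto
  have hAf : A = Finset.univ.erase f := by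
    ext x; rw [hmem, Finset.mem_erase]; simp
  -- a relabelling σ with σ o = 0 and σ A canonical
  have main : ∀ (σ : Equiv.Perm (Fin 6)) (As : List (Fin 6)), σ o = 0 → A.map σ.toEmbedding = As.toFinset →
      (∀ (w' : Sym2 (Fin 6) → unitInterval),
        4 < (∑ x ∈ As.toFinset, (prodBernoulli w').real (openConn (0 : Fin 6) x)) → ∀ t' : ℝ, 0 ≤ t' →
        (∀ x ∈ As.toFinset, ∀ x' ∈ As.toFinset, x ≠ x' → (prodBernoulli w').real (openConn x x')ᶜ ≤ t') →
        (prodBernoulli w').real {ω : Set (Sym2 (Fin 6)) | 1 ≤ (As.toFinset.filter fun x => ω ∈ openConn (0 : Fin 6) x).card ∧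
          (As.toFinset.filter fun x => ω ∈ openConn (0 : Fin 6) x).card ≤ 2} ≤ t') →
      (prodBernoulli w).real {ω : BondConfig (Fin 6) |
          1 ≤ (A.filter fun a => ω ∈ openConn o a).card ∧
          ((A.filter fun a => ω ∈ openConn o a).card : ℝ) <
            (∑ a ∈ A, (prodBernoulli w).real (openConn o a)) / 2} ≤ t := by
    intro σ As hσo hAm hcan
    refine oneCut_of_relabel σ w A o t (fun ht' hcut' => ?_) ht hcut
    have hmean := sum_openConn_relabelW σ w A o
    have hcard : (A.map σ.toEmbedding).card = 5 := by rw [Finset.card_map, hA]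
    refine le_trans (measureReal_mono (oneCut_event_subset (relabelW σ w) (A.map σ.toEmbedding) (σ o) hcard)) ?_
    have hEN' : 4 < ∑ x ∈ As.toFinset, (prodBernoulli (relabelW σ w)).real (openConn (0 : Fin 6) x) := by
      rw [← hAm, ← hσo, hmean]; exact hEN
    have hcut'' : ∀ x ∈ As.toFinset, ∀ x' ∈ As.toFinset, x ≠ x' →
        (prodBernoulli (relabelW σ w)).real (openConn x x')ᶜ ≤ t := by
      rw [← hAm]; exact hcut'
    have := hcan (relabelW σ w) hEN' t ht' hcut''
    rw [← hAm, ← hσo] at this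
    exact this
  by_cases hof : o = f
  · -- observer not a relay: σ = swap o 0, canonical list As6B
    refine main (Equiv.swap o 0) As6B (Equiv.swap_apply_left o 0) ?_ hOut
    rw [hAf, Finset.map_erase, Finset.map_univ_equiv, toFinset_As6B, Equiv.toEmbedding_apply, ← hof,
      Equiv.swap_apply_left]
  · -- observer a relay: σ o = 0, σ f = 5, canonical list As6A
    obtain ⟨σ, hσo, hσf⟩ := exists_perm_zero_five o f hof
    refine main σ As6A hσo ?_ hIn
    rw [hAf, Finset.map_erase, Finset.map_univ_equiv, toFinset_As6A, Equiv.toEmbedding_apply, hσf]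

end Summit.CriticalPhenomena.PercolationContinuityZ3.Theorems.TwoCopy
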